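import Summits.AtomisticToContinuum.Crystallization.Theorems.ShellTrichotomy.Negative.WithoutHardCore

/-!
# `ShellTrichotomy` (stmt-AtomisticToContinuum-18070), negative side VI: the radius window is load-bearing
# for `stub_noAntiprism` of line `Sketch`

`stub_noAntiprism` (skeleton `Cruxes/ShellTrichotomy/Lines/Sketch.lean`): a twelve-tuple with radii in
`[49/50, 51/50]`, pairs hard-cored and bond-or-far, whose bonds are EXACTLY the labelled hexagonal-antiprism
graph (ring `0…5`, ring `6…11`, label `i` bonded to `6+i` and `6+(i−1 mod 6)`), does not exist.
`stub_noAntiprism_false_without_radiusWindow`: delete the radius hypothesis and it is FALSE — the inscribed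
regular hexagonal antiprism `ApInt` of `WithoutHardCore.lean`, rescaled by `100/92` (so its 24 edges become bonds
`0.9929…1.0109 ∈ [49/50, 51/50]`, every other pair `≥ 1.369 ≥ 63/50`, radii `≈ 1.087` — outside the window, which
is the point) and LABELLED in the stub's order (`apVec`), satisfies the two remaining hypotheses.  So the antiprism
kill must use the radius window (numerically it needs radius/bond ratio `< 1/1.045`; the crux has `51/49 = 1.041`):
together with `shellTrichotomy_false_without_hardCore` (same solid, inscribed: bonds `0.92`) this brackets the stub —
it is the COUPLING of the radius ceiling `51/50` with the bond floor `49/50` that excludes the two-hexagon map.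
Negative-side support for the crux item; disprover seat refuter-cdisprove-stmt-AtomisticToContinuum-18070-0,
2026-08-17.
-/

noncomputable section

namespace Summit.AtomisticToContinuum.Crystallization.Theorems.ShellTrichotomyNegative

open Literature.Geometry.DiscreteGeometry
open Summit.AtomisticToContinuum.Crystallization.Theorems.ShellCensusNegative

/-- the inscribed regular hexagonal antiprism (`ApInt`, scale `100`) as a tuple LABELLED in the stub's antiprism
order: top ring `0…5` (angles `60°·i`), bottom ring `6…11` (angles `60°·j + 30°`). [folklore] -/
def apVec : Fin 12 → (Fin 3 → ℤ) :=
  ![![92, 0, 39], ![46, 80, 39], ![-46, 80, 39], ![-92, 0, 39], ![-46, -80, 39], ![46, -80, 39],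
    ![80, 46, -39], ![0, 92, -39], ![-80, 46, -39], ![-80, -46, -39], ![0, -92, -39], ![80, -46, -39]]

/-- squared integer pair lengths: all `≥ 8344`, and `≤ 8649` (edge) or `≥ 15876` (non-edge). [folklore] -/
theorem apVec_pairs : ∀ k l : Fin 12, k ≠ l → (8344 : ℤ) ≤ sqNormInt (apVec k - apVec l) ∧
    (sqNormInt (apVec k - apVec l) ≤ 8649 ∨ (15876 : ℤ) ≤ sqNormInt (apVec k - apVec l)) := by
  decide +kernel

/-- the short pairs (`≤ 8805 = ⌊(1.02·92)²⌋`) are exactly the labelled antiprism edges. [folklore] -/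
theorem apVec_bond_iff : ∀ k l : Fin 12, k ≠ l → (sqNormInt (apVec k - apVec l) ≤ 8805 ↔
    (min k.val l.val, max k.val l.val) ∈
      ([(0, 1), (1, 2), (2, 3), (3, 4), (4, 5), (0, 5), (6, 7), (7, 8), (8, 9), (9, 10), (10, 11), (6, 11), (0, 6), (1, 7),
        (2, 8), (3, 9), (4, 10), (5, 11), (1, 6), (2, 7), (3, 8), (4, 9), (5, 10), (0, 11)] : List (ℕ × ℕ))) := by
  decide +kernel

/-- **the rescaled antiprism tuple** `apVec / 92`. [folklore] -/
def apT (k : Fin 12) : EuclideanSpace ℝ (Fin 3) := ((92 : ℕ) : ℝ)⁻¹ • intVec (apVec k)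

/-- its pair distances from the integer model. [folklore] -/
theorem dist_apT (k l : Fin 12) :
    dist (apT k) (apT l) = Real.sqrt (sqNormInt (apVec k - apVec l) : ℝ) / (92 : ℕ) :=
  dist_div_intVec _ _ _

/-- bond test in integers at scale `92`: `dist ≤ 51/50 ↔ squared integer distance ≤ 8805`. [folklore] -/
theorem dist_apT_le_iff (k l : Fin 12) : dist (apT k) (apT l) ≤ 1 + 1 / 50 ↔ sqNormInt (apVec k - apVec l) ≤ 8805 := by
  rw [dist_apT, sqrt_div_le_iff (by norm_num) (Literature.Barriers.AtomisticToContinuum.sqNormInt_nonneg _) (by norm_num)]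
  constructor
  · intro h
    have h' : (sqNormInt (apVec k - apVec l) : ℝ) < ((8806 : ℤ) : ℝ) := by push_cast at h ⊢; nlinarith [h]
    have h'' : sqNormInt (apVec k - apVec l) < 8806 := by exact_mod_cast h'
    omega
  · intro h
    have h' : (sqNormInt (apVec k - apVec l) : ℝ) ≤ ((8805 : ℤ) : ℝ) := by exact_mod_cast h
    push_cast at h' ⊢; nlinarith [h']

/-- hypothesis `hd` of the stub (hard core; bond or far) for the rescaled antiprism. [folklore] -/
theorem apT_hd : ∀ k l : Fin 12, k ≠ l → 1 - 1 / 50 ≤ dist (apT k) (apT l) ∧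
    (dist (apT k) (apT l) ≤ 1 + 1 / 50 ∨ 63 / 50 ≤ dist (apT k) (apT l)) := by
  intro k l hkl
  obtain ⟨h1, h2⟩ := apVec_pairs k l hkl
  have h1' : ((8344 : ℤ) : ℝ) ≤ (sqNormInt (apVec k - apVec l) : ℝ) := by exact_mod_cast h1
  have hq := Literature.Barriers.AtomisticToContinuum.sqNormInt_nonneg (apVec k - apVec l)
  rw [dist_apT]
  refine ⟨(le_sqrt_div_iff (by norm_num) hq (by norm_num)).2 (by push_cast at h1' ⊢; nlinarith [h1']), ?_⟩
  rcases h2 with h2 | h2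
  · left
    have h2' : (sqNormInt (apVec k - apVec l) : ℝ) ≤ ((8649 : ℤ) : ℝ) := by exact_mod_cast h2
    exact (sqrt_div_le_iff (by norm_num) hq (by norm_num)).2 (by push_cast at h2' ⊢; nlinarith [h2'])
  · right
    have h2' : ((15876 : ℤ) : ℝ) ≤ (sqNormInt (apVec k - apVec l) : ℝ) := by exact_mod_cast h2
    exact (le_sqrt_div_iff (by norm_num) hq (by norm_num)).2 (by push_cast at h2' ⊢; nlinarith [h2'])

/-- hypothesis `hG` of the stub (bonds are exactly the labelled antiprism edges) for the rescaled antiprism.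
[folklore] -/
theorem apT_hG : ∀ k l : Fin 12, k ≠ l → (dist (apT k) (apT l) ≤ 1 + 1 / 50 ↔
    (min k.val l.val, max k.val l.val) ∈
      ([(0, 1), (1, 2), (2, 3), (3, 4), (4, 5), (0, 5), (6, 7), (7, 8), (8, 9), (9, 10), (10, 11), (6, 11), (0, 6), (1, 7),
        (2, 8), (3, 9), (4, 10), (5, 11), (1, 6), (2, 7), (3, 8), (4, 9), (5, 10), (0, 11)] : List (ℕ × ℕ))) := by
  intro k l hkl
  rw [dist_apT_le_iff]
  exact apVec_bond_iff k l hkl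

/-- **`stub_noAntiprism` without its radius hypothesis is false**: the rescaled inscribed antiprism `apT`
satisfies the hard-core/bond-or-far hypothesis and has exactly the labelled antiprism bonds. [folklore] -/
theorem stub_noAntiprism_false_without_radiusWindow :
    ¬ (∀ t : Fin 12 → EuclideanSpace ℝ (Fin 3),
        (∀ k l, k ≠ l → 1 - 1 / 50 ≤ dist (t k) (t l) ∧ (dist (t k) (t l) ≤ 1 + 1 / 50 ∨ 63 / 50 ≤ dist (t k) (t l))) →
        (∀ k l, k ≠ l → (dist (t k) (t l) ≤ 1 + 1 / 50 ↔ (min k.val l.val, max k.val l.val) ∈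
          ([(0, 1), (1, 2), (2, 3), (3, 4), (4, 5), (0, 5), (6, 7), (7, 8), (8, 9), (9, 10), (10, 11), (6, 11), (0, 6), (1, 7),
            (2, 8), (3, 9), (4, 10), (5, 11), (1, 6), (2, 7), (3, 8), (4, 9), (5, 10), (0, 11)] : List (ℕ × ℕ)))) →
        False) :=
  fun h => h apT apT_hd apT_hG

end Summit.AtomisticToContinuum.Crystallization.Theorems.ShellTrichotomyNegative

end
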